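import Summits.AtomisticToContinuum.HydrodynamicLimit.Theorems.CollisionIsometryCLTMacroClosureStubLedgerScaling

/-!
# `BlockGibbsToRelEntropy` (stmt-AtomisticToContinuum-13464), IV: the mean log-profile pairing through the mean empirical fields

Route JaynesSqueeze, support item `BlockGibbsToRelEntropy`, step (d) ("bookkeeping at the Euler-driven
reference"). The relative entropy of the law at time `t` with respect to a local Gibbs reference is
`(N+1)·(E⟨emp z, log prof₀⟩ − E⟨emp (Φ_t z), log prof_ψ⟩) + log Z_ψ − log Z₀` (companion file `…Ledger`); this
file expresses the time-`t` pairing through the three EMPIRICAL FIELDS of the conjunct and passes to the limit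
under convergence of their MEANS:

* `logPair_eq_fields` — pointwise, for a local Gibbs profile with `b, ϑ > 0`:
  `⟨emp z, log prof_{b,w,ϑ}⟩ = ρ̂_z(log b + log (2πϑ)^{-3/2} − |w|²/(2ϑ)) + Σⱼ (ĵ_z(wⱼ/ϑ))ⱼ − ê_z(ϑ⁻¹)`
  (`ρ̂, ĵ, ê` = `empiricalDensityField`, `empiricalMomentumField`, `empiricalEnergyField`);
* `integrable_empiricalDensityField_comp`, `integrable_empiricalMomentumField_comp`,
  `integrable_empiricalEnergyField_comp` — the three fields of `T z` (any measurable `T`, e.g. `Φ_t`) tested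
  against a bounded continuous `χ` are integrable under a finite law as soon as the kinetic energy of `T z` is
  (`|vⱼ| ≤ (1 + |v|²)/2`);
* `integral_logPair_comp_eq_fields` — hence the MEAN pairing is the same combination of the MEAN fields;
* `tendsto_integral_logPair_comp` — and if the mean fields of `T_N z` converge (tested against every continuous
  `χ`) to `∫ χ ρ₁`, `∫ χ mⱼ`, `∫ χ e`, the mean pairing converges to
  `∫ ρ₁ (log b + log (2πϑ)^{-3/2} − |w|²/(2ϑ)) + Σⱼ ∫ mⱼ wⱼ/ϑ − ∫ e/ϑ`.

All objects are the tree's; no definitions. prover-pitem-stmt-AtomisticToContinuum-13464-0.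
-/

noncomputable section

namespace Summit.AtomisticToContinuum.HydrodynamicLimit.Theorems.JaynesSqueezeClosure

open MeasureTheory Filter Set Topology
open scoped ENNReal
open Literature.MathematicalPhysics.KineticTheory Literature.Analysis.FluidPDE Literature.Analysis.FunctionSpaces
open MacroClosureLine.StubLedger

variable {b ϑ : T3 → ℝ} {w : T3 → V3}

/-! ### §1 The log-profile pairing through the empirical fields -/

/-- **The empirical log-profile pairing of a local Gibbs profile is a combination of the three empirical
fields**: for `b, ϑ > 0` pointwise and any configuration `z` of `N + 1` particles,
`⟨emp z, log prof_{b,w,ϑ}⟩ = ρ̂_z(log b + log (2πϑ)^{-3/2} − |w|²/(2ϑ)) + Σⱼ (ĵ_z(wⱼ/ϑ))ⱼ − ê_z(ϑ⁻¹)`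
(expand `−|v − w|²/(2ϑ) = −|v|²/(2ϑ) + ⟪v, w⟫/ϑ − |w|²/(2ϑ)`). [folklore] -/
theorem logPair_eq_fields {N : ℕ} (hb0 : ∀ x, 0 < b x) (hϑ0 : ∀ x, 0 < ϑ x)
    (z : Config (N + 1) (Fin 3) T3) :
    (∫ y, Real.log (localGibbsProfile b w ϑ y) ∂(empiricalMeasure z)) =
      empiricalDensityField z (fun x => Real.log (b x) +
          Real.log ((2 * Real.pi * ϑ x) ^ (-(Module.finrank ℝ V3 : ℝ) / 2)) - ‖w x‖ ^ 2 / (2 * ϑ x)) +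
        (∑ j, empiricalMomentumField z (fun x => w x j / ϑ x) j) -
        empiricalEnergyField z (fun x => (ϑ x)⁻¹) := by
  rw [logPair_eq_sum, empiricalDensityField_eq_sum, empiricalEnergyField_eq_sum]
  simp_rw [empiricalMomentumField_eq_sum]
  simp only [PiLp.smul_apply, WithLp.ofLp_sum, Finset.sum_apply, smul_eq_mul]
  push_cast
  have key : ∀ i : Fin (N + 1), Real.log (localGibbsProfile b w ϑ (z i)) =
      (Real.log (b (z i).1) + Real.log ((2 * Real.pi * ϑ (z i).1) ^ (-(Module.finrank ℝ V3 : ℝ) / 2)) -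
          ‖w (z i).1‖ ^ 2 / (2 * ϑ (z i).1)) +
        (∑ j, w (z i).1 j / ϑ (z i).1 * (z i).2 j) - (ϑ (z i).1)⁻¹ * (‖(z i).2‖ ^ 2 / 2) := by
    intro i
    have hϑi := (hϑ0 (z i).1).ne'
    have hin : inner ℝ ((z i).2) (w (z i).1) = ∑ j, w (z i).1 j * (z i).2 j := by
      rw [PiLp.inner_apply]
      simp [mul_comm]
    have hsum : ∑ j, w (z i).1 j / ϑ (z i).1 * (z i).2 j = (∑ j, w (z i).1 j * (z i).2 j) / ϑ (z i).1 := by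
      rw [Finset.sum_div]
      exact Finset.sum_congr rfl fun j _ => by ring
    rw [log_localGibbsProfile_eq (z i).1 (z i).2 (hb0 _) (hϑ0 _), @norm_sub_sq_real, hin, hsum]
    field_simp
    ring
  simp_rw [key]
  rw [Finset.sum_sub_distrib, Finset.sum_add_distrib, mul_sub, mul_add]
  congr 2
  simp_rw [Finset.mul_sum]
  exact Finset.sum_comm

/-! ### §2 Integrability of the empirical fields along a measurable map -/

variable {N : ℕ} {P : Measure (Config (N + 1) (Fin 3) T3)}
  {T : Config (N + 1) (Fin 3) T3 → Config (N + 1) (Fin 3) T3}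

/-- The empirical density field of `T z` tested against a bounded continuous `χ` is integrable under a finite
law (it is bounded by `sup |χ|`). [folklore] -/
theorem integrable_empiricalDensityField_comp [IsFiniteMeasure P] (hT : Measurable T) {χ : T3 → ℝ}
    (hχ : Continuous χ) : Integrable (fun z => empiricalDensityField (T z) χ) P := by
  obtain ⟨C, -, hC⟩ := exists_forall_abs_le_of_continuous hχ
  have hm : Measurable fun z : Config (N + 1) (Fin 3) T3 => empiricalDensityField z χ := by
    simp_rw [empiricalDensityField_eq_sum]
    exact measurable_const.mul (Finset.measurable_sum _ fun i _ => hχ.measurable.comp (measurable_pi_apply i).fst)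
  refine (integrable_const C).mono' (hm.comp hT).aestronglyMeasurable (ae_of_all _ fun z => ?_)
  rw [Real.norm_eq_abs, empiricalDensityField_eq_sum, abs_mul, abs_of_nonneg (by positivity)]
  push_cast
  calc ((N : ℝ) + 1)⁻¹ * |∑ i, χ (T z i).1| ≤ ((N : ℝ) + 1)⁻¹ * ∑ i : Fin (N + 1), C := by
        refine mul_le_mul_of_nonneg_left ((Finset.abs_sum_le_sum_abs _ _).trans
          (Finset.sum_le_sum fun i _ => hC _)) (by positivity)
    _ = C := by
        rw [Finset.sum_const, Finset.card_univ, Fintype.card_fin, nsmul_eq_mul]; push_cast; field_simp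

/-- A coordinate of the empirical momentum field of `T z` tested against a bounded continuous `χ` is
integrable under a finite law once the kinetic energy of `T z` is (`|vⱼ| ≤ |v| ≤ (1 + |v|²)/2`). [folklore] -/
theorem integrable_empiricalMomentumField_comp [IsFiniteMeasure P] (hT : Measurable T) {χ : T3 → ℝ}
    (hχ : Continuous χ) (hK : Integrable (fun z => ∫ y, ‖y.2‖ ^ 2 ∂(empiricalMeasure (T z))) P)
    (j : Fin 3) : Integrable (fun z => empiricalMomentumField (T z) χ j) P := by
  obtain ⟨C, hC0, hC⟩ := exists_forall_abs_le_of_continuous hχ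
  have hm : Measurable fun z : Config (N + 1) (Fin 3) T3 => empiricalMomentumField z χ j := by
    have h : (fun z : Config (N + 1) (Fin 3) T3 => empiricalMomentumField z χ j) =
        fun z => ((N + 1 : ℕ) : ℝ)⁻¹ * ∑ i, χ (z i).1 * (z i).2 j := by
      funext z
      rw [empiricalMomentumField_eq_sum]
      simp only [PiLp.smul_apply, WithLp.ofLp_sum, Finset.sum_apply, smul_eq_mul, Finset.mul_sum]
    rw [h]
    refine measurable_const.mul (Finset.measurable_sum _ fun i _ => ?_)
    exact (hχ.measurable.comp (measurable_pi_apply i).fst).mul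
      ((EuclideanSpace.proj j : V3 →L[ℝ] ℝ).measurable.comp (measurable_pi_apply i).snd)
  refine ((integrable_const (C / 2)).add (hK.const_mul (C / 2))).mono' (hm.comp hT).aestronglyMeasurable
    (ae_of_all _ fun z => ?_)
  simp only [Pi.add_apply]
  rw [Real.norm_eq_abs, empiricalMomentumField_eq_sum, kineticPair_eq_sum]
  simp only [PiLp.smul_apply, WithLp.ofLp_sum, Finset.sum_apply, smul_eq_mul]
  push_cast
  rw [abs_mul, abs_of_nonneg (show (0 : ℝ) ≤ ((N : ℝ) + 1)⁻¹ by positivity)]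
  have hterm : ∀ i : Fin (N + 1), |χ (T z i).1 * (T z i).2 j| ≤ C / 2 * (1 + ‖(T z i).2‖ ^ 2) := by
    intro i
    rw [abs_mul]
    have h1 : |(T z i).2 j| ≤ ‖(T z i).2‖ := by
      simpa [Real.norm_eq_abs] using PiLp.norm_apply_le ((T z i).2) j
    have h2 : ‖(T z i).2‖ ≤ (1 + ‖(T z i).2‖ ^ 2) / 2 := by nlinarith [sq_nonneg (‖(T z i).2‖ - 1)]
    calc |χ (T z i).1| * |(T z i).2 j| ≤ C * ((1 + ‖(T z i).2‖ ^ 2) / 2) :=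
          mul_le_mul (hC _) (h1.trans h2) (abs_nonneg _) hC0
      _ = C / 2 * (1 + ‖(T z i).2‖ ^ 2) := by ring
  calc ((N : ℝ) + 1)⁻¹ * |∑ i, χ (T z i).1 * (T z i).2 j|
      ≤ ((N : ℝ) + 1)⁻¹ * ∑ i, C / 2 * (1 + ‖(T z i).2‖ ^ 2) :=
        mul_le_mul_of_nonneg_left ((Finset.abs_sum_le_sum_abs _ _).trans (Finset.sum_le_sum fun i _ => hterm i))
          (by positivity)
    _ = C / 2 + C / 2 * (((N : ℝ) + 1)⁻¹ * ∑ i, ‖(T z i).2‖ ^ 2) := by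
        rw [← Finset.mul_sum, Finset.sum_add_distrib, Finset.sum_const, Finset.card_univ, Fintype.card_fin,
          nsmul_eq_mul]
        push_cast
        field_simp

/-- The empirical energy field of `T z` tested against a bounded continuous `χ` is integrable under a finite law
once the kinetic energy of `T z` is. [folklore] -/
theorem integrable_empiricalEnergyField_comp [IsFiniteMeasure P] (hT : Measurable T) {χ : T3 → ℝ}
    (hχ : Continuous χ) (hK : Integrable (fun z => ∫ y, ‖y.2‖ ^ 2 ∂(empiricalMeasure (T z))) P) :
    Integrable (fun z => empiricalEnergyField (T z) χ) P := by
  obtain ⟨C, hC0, hC⟩ := exists_forall_abs_le_of_continuous hχ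
  have hm : Measurable fun z : Config (N + 1) (Fin 3) T3 => empiricalEnergyField z χ := by
    simp_rw [empiricalEnergyField_eq_sum]
    refine measurable_const.mul (Finset.measurable_sum _ fun i _ => ?_)
    exact (hχ.measurable.comp (measurable_pi_apply i).fst).mul
      (((measurable_pi_apply i).snd.norm.pow_const 2).div_const 2)
  refine (hK.const_mul (C / 2)).mono' (hm.comp hT).aestronglyMeasurable (ae_of_all _ fun z => ?_)
  rw [Real.norm_eq_abs, empiricalEnergyField_eq_sum, kineticPair_eq_sum]
  push_cast
  rw [abs_mul, abs_of_nonneg (show (0 : ℝ) ≤ ((N : ℝ) + 1)⁻¹ by positivity)]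
  have hterm : ∀ i : Fin (N + 1), |χ (T z i).1 * (‖(T z i).2‖ ^ 2 / 2)| ≤ C / 2 * ‖(T z i).2‖ ^ 2 := by
    intro i
    rw [abs_mul, abs_of_nonneg (show (0 : ℝ) ≤ ‖(T z i).2‖ ^ 2 / 2 by positivity)]
    calc |χ (T z i).1| * (‖(T z i).2‖ ^ 2 / 2) ≤ C * (‖(T z i).2‖ ^ 2 / 2) :=
          mul_le_mul_of_nonneg_right (hC _) (by positivity)
      _ = C / 2 * ‖(T z i).2‖ ^ 2 := by ring
  calc ((N : ℝ) + 1)⁻¹ * |∑ i, χ (T z i).1 * (‖(T z i).2‖ ^ 2 / 2)|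
      ≤ ((N : ℝ) + 1)⁻¹ * ∑ i, C / 2 * ‖(T z i).2‖ ^ 2 :=
        mul_le_mul_of_nonneg_left ((Finset.abs_sum_le_sum_abs _ _).trans (Finset.sum_le_sum fun i _ => hterm i))
          (by positivity)
    _ = C / 2 * (((N : ℝ) + 1)⁻¹ * ∑ i, ‖(T z i).2‖ ^ 2) := by rw [← Finset.mul_sum]; ring

/-! ### §3 The mean pairing through the mean fields, and its limit -/

/-- **The mean log-profile pairing along a measurable map is a combination of the mean empirical fields.**
For a finite law `P`, a measurable `T` with `P`-integrable kinetic energy of `T z`, and continuous `b, ϑ > 0`,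
`w`: `E_P⟨emp (T z), log prof_{b,w,ϑ}⟩ = E_P[ρ̂(χ₁)] + Σⱼ E_P[(ĵ(wⱼ/ϑ))ⱼ] − E_P[ê(ϑ⁻¹)]` with
`χ₁ = log b + log (2πϑ)^{-3/2} − |w|²/(2ϑ)`. [folklore] -/
theorem integral_logPair_comp_eq_fields [IsFiniteMeasure P] (hT : Measurable T) (hb : Continuous b)
    (hϑ : Continuous ϑ) (hw : Continuous w) (hb0 : ∀ x, 0 < b x) (hϑ0 : ∀ x, 0 < ϑ x)
    (hK : Integrable (fun z => ∫ y, ‖y.2‖ ^ 2 ∂(empiricalMeasure (T z))) P) :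
    ∫ z, (∫ y, Real.log (localGibbsProfile b w ϑ y) ∂(empiricalMeasure (T z))) ∂P =
      (∫ z, empiricalDensityField (T z) (fun x => Real.log (b x) +
          Real.log ((2 * Real.pi * ϑ x) ^ (-(Module.finrank ℝ V3 : ℝ) / 2)) - ‖w x‖ ^ 2 / (2 * ϑ x)) ∂P) +
        (∑ j, ∫ z, empiricalMomentumField (T z) (fun x => w x j / ϑ x) j ∂P) -
        ∫ z, empiricalEnergyField (T z) (fun x => (ϑ x)⁻¹) ∂P := by
  have hχ₁ : Continuous fun x => Real.log (b x) +
      Real.log ((2 * Real.pi * ϑ x) ^ (-(Module.finrank ℝ V3 : ℝ) / 2)) - ‖w x‖ ^ 2 / (2 * ϑ x) := by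
    have hRc : Continuous fun x => (2 * Real.pi * ϑ x) ^ (-(Module.finrank ℝ V3 : ℝ) / 2) :=
      (continuous_const.mul hϑ).rpow_const fun x => Or.inl (mul_pos (mul_pos two_pos Real.pi_pos) (hϑ0 x)).ne'
    refine ((hb.log fun x => (hb0 x).ne').add (hRc.log fun x =>
      (Real.rpow_pos_of_pos (mul_pos (mul_pos two_pos Real.pi_pos) (hϑ0 x)) _).ne')).sub ?_
    exact (hw.norm.pow 2).div (continuous_const.mul hϑ) fun x => (mul_pos two_pos (hϑ0 x)).ne'
  have hχ₂ : ∀ j : Fin 3, Continuous fun x => w x j / ϑ x := fun j =>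
    ((EuclideanSpace.proj j).continuous.comp hw).div hϑ fun x => (hϑ0 x).ne'
  have hχ₃ : Continuous fun x => (ϑ x)⁻¹ := hϑ.inv₀ fun x => (hϑ0 x).ne'
  have hI₁ := integrable_empiricalDensityField_comp (P := P) hT hχ₁
  have hI₂ : ∀ j : Fin 3, Integrable (fun z => empiricalMomentumField (T z) (fun x => w x j / ϑ x) j) P :=
    fun j => integrable_empiricalMomentumField_comp hT (hχ₂ j) hK j
  have hI₃ := integrable_empiricalEnergyField_comp (P := P) hT hχ₃ hK
  have hI₂' : Integrable (fun z => ∑ j, empiricalMomentumField (T z) (fun x => w x j / ϑ x) j) P :=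
    integrable_finsetSum _ fun j _ => hI₂ j
  simp_rw [logPair_eq_fields (w := w) hb0 hϑ0]
  rw [integral_sub (f := fun z => empiricalDensityField (T z) (fun x => Real.log (b x) +
        Real.log ((2 * Real.pi * ϑ x) ^ (-(Module.finrank ℝ V3 : ℝ) / 2)) - ‖w x‖ ^ 2 / (2 * ϑ x)) +
      ∑ j, empiricalMomentumField (T z) (fun x => w x j / ϑ x) j) (hI₁.add hI₂') hI₃,
    integral_add hI₁ hI₂', integral_finsetSum _ fun j _ => hI₂ j]

/-- **Limit of the mean log-profile pairing along a sequence of maps under convergence of the mean empirical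
fields.** For finite laws `P_N` on `(N+1)`-particle phase space, measurable maps `T_N` with `P_N`-integrable
kinetic energy of `T_N z`, continuous `b, ϑ > 0`, `w`, and functions `ρ₁, e : 𝕋³ → ℝ`, `m : 𝕋³ → ℝ³`: if for
every continuous `χ` the means of `ρ̂_{T_N z}(χ)`, `(ĵ_{T_N z}(χ))ⱼ`, `ê_{T_N z}(χ)` tend to `∫ χ ρ₁`, `∫ χ mⱼ`,
`∫ χ e`, then `E_{P_N}⟨emp (T_N z), log prof_{b,w,ϑ}⟩ → ∫ χ₁ ρ₁ + Σⱼ ∫ (wⱼ/ϑ) mⱼ − ∫ ϑ⁻¹ e`. [folklore] -/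
theorem tendsto_integral_logPair_comp (P : (N : ℕ) → Measure (Config (N + 1) (Fin 3) T3))
    [∀ N, IsFiniteMeasure (P N)] (T : (N : ℕ) → Config (N + 1) (Fin 3) T3 → Config (N + 1) (Fin 3) T3)
    (hT : ∀ N, Measurable (T N)) (hb : Continuous b) (hϑ : Continuous ϑ) (hw : Continuous w)
    (hb0 : ∀ x, 0 < b x) (hϑ0 : ∀ x, 0 < ϑ x)
    (hK : ∀ N, Integrable (fun z => ∫ y, ‖y.2‖ ^ 2 ∂(empiricalMeasure (T N z))) (P N))
    {ρ₁ e : T3 → ℝ} {m : T3 → V3}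
    (hD : ∀ χ : T3 → ℝ, Continuous χ →
      Tendsto (fun N => ∫ z, empiricalDensityField (T N z) χ ∂(P N)) atTop (𝓝 (∫ x, χ x * ρ₁ x)))
    (hM : ∀ χ : T3 → ℝ, Continuous χ → ∀ j : Fin 3,
      Tendsto (fun N => ∫ z, empiricalMomentumField (T N z) χ j ∂(P N)) atTop (𝓝 (∫ x, χ x * m x j)))
    (hE : ∀ χ : T3 → ℝ, Continuous χ →
      Tendsto (fun N => ∫ z, empiricalEnergyField (T N z) χ ∂(P N)) atTop (𝓝 (∫ x, χ x * e x))) :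
    Tendsto (fun N => ∫ z, (∫ y, Real.log (localGibbsProfile b w ϑ y) ∂(empiricalMeasure (T N z))) ∂(P N))
      atTop (𝓝 ((∫ x, (Real.log (b x) + Real.log ((2 * Real.pi * ϑ x) ^ (-(Module.finrank ℝ V3 : ℝ) / 2)) -
          ‖w x‖ ^ 2 / (2 * ϑ x)) * ρ₁ x) +
        (∑ j, ∫ x, (w x j / ϑ x) * m x j) - ∫ x, (ϑ x)⁻¹ * e x)) := by
  have hχ₁ : Continuous fun x => Real.log (b x) +
      Real.log ((2 * Real.pi * ϑ x) ^ (-(Module.finrank ℝ V3 : ℝ) / 2)) - ‖w x‖ ^ 2 / (2 * ϑ x) := by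
    have hRc : Continuous fun x => (2 * Real.pi * ϑ x) ^ (-(Module.finrank ℝ V3 : ℝ) / 2) :=
      (continuous_const.mul hϑ).rpow_const fun x => Or.inl (mul_pos (mul_pos two_pos Real.pi_pos) (hϑ0 x)).ne'
    refine ((hb.log fun x => (hb0 x).ne').add (hRc.log fun x =>
      (Real.rpow_pos_of_pos (mul_pos (mul_pos two_pos Real.pi_pos) (hϑ0 x)) _).ne')).sub ?_
    exact (hw.norm.pow 2).div (continuous_const.mul hϑ) fun x => (mul_pos two_pos (hϑ0 x)).ne'
  have hχ₂ : ∀ j : Fin 3, Continuous fun x => w x j / ϑ x := fun j =>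
    ((EuclideanSpace.proj j).continuous.comp hw).div hϑ fun x => (hϑ0 x).ne'
  have hχ₃ : Continuous fun x => (ϑ x)⁻¹ := hϑ.inv₀ fun x => (hϑ0 x).ne'
  have h := ((hD _ hχ₁).add (tendsto_finsetSum (Finset.univ : Finset (Fin 3))
    fun j _ => hM _ (hχ₂ j) j)).sub (hE _ hχ₃)
  refine h.congr fun N => ?_
  rw [integral_logPair_comp_eq_fields (hT N) hb hϑ hw hb0 hϑ0 (hK N)]

end Summit.AtomisticToContinuum.HydrodynamicLimit.Theorems.JaynesSqueezeClosure

end
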